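import Mathlib.RingTheory.Kaehler.Basic
import Mathlib.RingTheory.KrullDimension.Basic
import Mathlib.RingTheory.IntegralClosure.IntegrallyClosed
import Mathlib.RingTheory.Noetherian.Basic
import Mathlib.RingTheory.MvPolynomial.Basic
import Literature.RingTheory.FittingIdeal.Basic
import Literature.RingTheory.CohomologyAnnihilator.Basic
import Literature.RingTheory.CohomologyAnnihilator.RegularRing
import HarnessLib

/-!
# The Kähler different of a Noether normalization annihilates `Ext^{d+1}` — Iyengar–Takahashi 2016, Theorem 3.8, ONE summand of
# `jac(R)`, specialised to normal domains of Krull dimension `3` (FACT-LIST label **F-89a′** = W4.4's (J′); general base, NO field,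
# NO Example 3.2)

Topic: `Literature/RingTheory/CohomologyAnnihilator` (sibling of `JacobianIdealAnnihilator.lean` = F-89b, the PERFECT-field classical form).
S. B. Iyengar, R. Takahashi, *The Jacobian ideal of a commutative ring and annihilators of cohomology*, J. Algebra 571 (2021) =
arXiv:1610.02599 (bib `IyengarTakahashi2016`; locators = the held arXiv text). Typer res-L1-s13-pv-1 g7 (custody DEAL #29 (2)) on
res-D-lit-1's farm-checked rendering 7c993716f5d829da (desk ruling #2 2026-08-27T16:51:38Z); c3 reader res-D-lit-1; desk res-dag-4.
Statement-only: users take `(h : jacobianFloorNN_normal_dim3)`; every close through it is ‖ K·F. Nothing of any manuscript under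
adjudication is involved; this is a SETTLED published theorem read NARROWER than print.

## The printed statements (read on the page) and the COMPOSITE CHAIN (each link = citation + ≤ 1 routine step)
(1) [IyengarTakahashi2016, **Thm 3.8**, p.8 L59–66]: *Let `R` be a commutative noetherian ring of Krull dimension `d`. If `R` is
    equidimensional and each `𝔭 ∈ Spec R` satisfies `2·depth R_𝔭 ≥ dim R_𝔭`, then `jac(R) · Ext^{d+1}_R(−,−) = 0`.* (No base field.)
(2°) DEFINITIONS ONLY (§3): the Kähler different `𝔡_K(R/A) := Fitt₀^R(Ω_{R/A})` (p.7 L7–10); a Noether normalization is a subring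
    `A ⊆ R` with `A` noetherian of finite global dimension and `R` module-finite over `A` (p.7 L22–28); `jac(R) := Σ_A 𝔡_K(R/A)` over all
    Noether normalizations (p.7 L44–50) — so EACH summand satisfies `Fitt₀(Ω_{R/A}) ≤ jac(R)`. «`A` noetherian of finite global dimension»
    is rendered `[IsNoetherianRing A]` + `∃ n, caⁿ(A) = ⊤`, EQUAL to print for noetherian `A` by [IyengarTakahashi2014, Example 2.5]
    (`gl.dim Λ ≤ d ⟺ ca^{d+1}(Λ) = Λ`; tree `cohomologyAnnihilatorOfDegree_eq_top_iff_hasProjectiveDimensionLT`).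
(3) equidimensional (p.8 L14, their definition: all `R/𝔮`, `𝔮` minimal, have the same dimension): a DOMAIN has one minimal prime.
(4) Serre's criterion [Matsumura1987, Thm 23.8]: a noetherian normal (= integrally closed) domain is `(S₂)`, `depth B_𝔭 ≥ min(2, dim B_𝔭)`,
    hence `2·depth B_𝔭 ≥ dim B_𝔭` whenever `dim B_𝔭 ≤ 4` — always when `dim B = 3`.
(5) «`I` annihilates `Ext^{d+1}_R(−,−)`» = `I · Ext^{d+1}(M,N) = 0` for ALL modules (p.7 L80–86) ⇒ `I ≤ ca^{d+1}(R)` = the tree's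
    `cohomologyAnnihilatorOfDegree R (d+1)` ([IyengarTakahashi2014, Def. 2.1]: ann `Ext^{≥ d+1}` on finitely generated modules).
Sanity (consumer shape, not vendored as a decl): a polynomial Noether normalization `k[y₁,y₂,y₃] → B` qualifies, since
`ca⁴(k[y₁,y₂,y₃]) = ⊤` is the tree's `cohomologyAnnihilatorOfDegree_mvPolynomial_eq_top`.

## What this file vendors
ONE statement-only `def jacobianFloorNN_normal_dim3 : Prop` (universe `u`: `B, A : Type u`, as `caⁿ` lives on `ModuleCat.{u}`) — for a
noetherian NORMAL DOMAIN `B` of Krull dimension `3` and every Noether normalization `A → B` (injective, `B` module-finite over `A`,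
`A` noetherian with `∃ n, caⁿ(A) = ⊤`): `Fitt₀(Ω[B⁄A]) ≤ ca⁴(B)`. NARROWER than print (one summand; `d = 3`; normal domains), never wider.
NOT vendored: the classical-Jacobian form (F-89b, `JacobianIdealAnnihilator.lean`, PERFECT fields only), Thm 1.1/3.4 (`jac^s`), Cor. 3.9.
AI bookkeeping weaker than expert review.
-/

noncomputable section

open Literature.RingTheory.FittingIdeal

universe u

namespace Literature.RingTheory.CohomologyAnnihilator

/-- **Named fact F-89a′ (W4.4's (J′)) — Iyengar–Takahashi 2016, Theorem 3.8, one summand of `jac`, normal domains of dimension 3.**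
Printed (p.8 L59–66): *Let `R` be a commutative noetherian ring of Krull dimension `d`. If `R` is equidimensional and each `𝔭 ∈ Spec R`
satisfies `2·depth R_𝔭 ≥ dim R_𝔭`, then `jac(R) · Ext^{d+1}_R(−,−) = 0`*, with `jac(R) = Σ_A Fitt₀(Ω_{R/A})` over the Noether
normalizations `A ⊆ R` (§3, p.7 L7–10, L22–28, L44–50). Here: for a noetherian normal domain `B` of Krull dimension `3` (equidimensional
as a domain, p.8 L14; `(S₂)` by [Matsumura1987, Thm 23.8], so `2·depth ≥ dim` throughout) and every Noether normalization `A → B`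
(`A` noetherian of finite global dimension — rendered `∃ n, caⁿ(A) = ⊤` [IyengarTakahashi2014, Ex. 2.5] —, `B` module-finite over `A`,
`A → B` injective), the Kähler different `Fitt₀(Ω[B⁄A])` kills `Extⁱ_B(M, N)` for all `i ≥ 4` and all finitely generated `M, N`:
`Fitt₀(Ω[B⁄A]) ≤ ca⁴(B)` (p.7 L80–86 ⇒ `cohomologyAnnihilatorOfDegree B 4`). Statement-only; users take `(h : jacobianFloorNN_normal_dim3)`;
FACT-LIST F-89a′ «composite (Thm 3.8 + §3 definitions + equidim + S₂)»; every close through it is ‖ K·F.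
[cite: IyengarTakahashi2016, Thm 3.8 (p.8 L59–66) with §3 definitions (p.7 L7–10, L22–28, L44–50, L80–86)] [cite: IyengarTakahashi2014, Example 2.5, Def. 2.1] [cite: Matsumura1987, Thm 23.8] -/
def jacobianFloorNN_normal_dim3 : Prop :=
  ∀ (B : Type u) [CommRing B] [IsNoetherianRing B] [IsDomain B],
    IsIntegrallyClosed B → ringKrullDim B = 3 →
    ∀ (A : Type u) [CommRing A] [IsNoetherianRing A] [Algebra A B] [Module.Finite A B],
      Function.Injective (algebraMap A B) → (∃ n : ℕ, cohomologyAnnihilatorOfDegree A n = ⊤) →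
        Module.fittingIdeal B (Ω[B⁄A]) 0 ≤ cohomologyAnnihilatorOfDegree B 4

end Literature.RingTheory.CohomologyAnnihilator

end
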